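import Mathlib.Topology.KrullDimension
import Mathlib.LinearAlgebra.TensorProduct.Tower
import Literature.AlgebraicGeometry.Motives.FamiliesVHS
import Literature.AlgebraicGeometry.Motives.HodgeTensor
import HarnessLib

/-!
# The Hodge locus of a variation of Hodge structure: special subvarieties, period dimension,
# atypical and maximal atypical special subvarieties (Baldi–Klingler–Ullmo)

Vocabulary to STATE the results of G. Baldi, B. Klingler, E. Ullmo, *On the distribution of the
Hodge locus*, Invent. Math. 235 (2024) [BaldiKlinglerUllmo2024, "BKU"] — Thm. 2.1 (geometric
Zilber–Pink), Thm. 2.3 (level `≥ 3` ⟹ typical locus empty), Thm. 2.6 (level `≥ 3` ⟹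
`HL(S, 𝕍^⊗)_fpos` is a finite union of maximal atypical special subvarieties, hence algebraic),
Cor. 2.7 (hypersurfaces of `ℙⁿ⁺¹`, `n ≥ 3`, `d > 5`); numbering of the held text
`paper:arxiv-2107.08838` (version of record) — over the tree's hypothesis structure
`VHSData S n` / `GeometricVHSData B f n i` (`Motives/FamiliesVHS`: the local systems `V_ℤ, V`, the
fibrewise Hodge structures and a flat polarization of a polarized `ℤ`VHS; holomorphy and
transversality are not recorded, so every notion below is "the printed one for `D` underlying an
honest polarized `ℤ`VHS on a smooth quasi-projective `S`").

BKU define everything through the period map `Φ : S^an → Γ \ D` (§3.3) and dimensions of complex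
analytic images, none of which exists in this tree (no Mumford–Tate domains, no analytic
dimension). The rendering below uses instead the INTRINSIC characterisations printed in BKU:

* **Mumford–Tate Lie algebra and ranks** (§3.1–3.2). `HodgeStructure.mumfordTateLieAlgebra H ⊆ 𝔤𝔩(V)`
  is the annihilator, under the derivation action `tensorSpaceDeriv` (built here from Mathlib's
  `PiTensorProduct.mapMultilinear`), of the weight-`0`, type-`(0,0)` rational tensors — the tensors
  whose stabiliser is the tree's `HodgeStructure.mumfordTateGroup` ("`MT(V)` is also the fixator
  in `GL(V)` of the Hodge tensors", BKU §3.1; Deligne, LNM 900, I 3.4), hence `Lie MT(H)`.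
  `mtRank H = dim MT(H)`, `mtDomainDim H = dim_ℂ 𝔪𝔱_ℂ / F⁰ 𝔪𝔱_ℂ = dim D_{MT(H)}` (tangent space
  of a Mumford–Tate domain, BKU §4.3). Proved: `tensorPowerDeriv_tprod`, `tensorSpaceDeriv_tmul`,
  `tensorSpaceDeriv_id` (`id` acts on `T^{a,b}` by `a - b`), `id_mem_mumfordTateLieAlgebra`
  (`n ≠ 0`), `mtRank_pos`.
* **Hodge-generic points, generic Mumford–Tate group, Hodge locus** (§3.2, verbatim): `s` is
  Hodge-generic in `Y` iff `dim MT(V_s)` is maximal on `Y` (`VHSData.IsHodgeGenericIn`);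
  `genericMTRank D Y = dim G_Y`; `hodgeLocus D = HL(S, 𝕍^⊗)` = the non-Hodge-generic points of `S`.
* **Special subvarieties** via BKU Lemma 3.6 (= Klingler–Otwinowska–Urbanik 2023, Prop. 2.1):
  "the closed irreducible algebraic `Y ⊂ S` maximal among the closed irreducible algebraic `Z`
  with `G_Z = G_Y`" (`VHSData.IsSpecialSubvariety`; for `Y ⊆ Z`, `G_Y ↪ G_Z` and both are
  connected, so `G_Z = G_Y` iff the dimensions agree). Closed irreducible algebraic subvarieties
  of `S` are handled through their complex points: `ZariskiPoints T L` is `T(L)` with the topology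
  induced from the scheme `T` (`isZariskiClosedOnPoints_iff_isClosed` links it to the existing
  `IsZariskiClosedOnPoints`), `IsIrreducibleZariskiClosedOnPoints`, `zariskiDimOnPoints`
  (Mathlib `topologicalKrullDim`), `IsIrredComponentOnPoints`.
* **Period dimension** (Def. 1.2) without `Φ`: `PeriodEquiv D s t` (transport along some path
  identifies the Hodge filtrations — "same value of the lifted period map"),
  `HasPositivePeriodDimension D Y` (two points of `Y` are not period-equivalent ⟺ `Φ` is not
  constant on the connected `Y^an`), and the number `periodDim D Y = dim Y - min_y dim`(period
  fibre through `y`)` = dim Φ(Y^an)` (fibres of period maps are algebraic, BKU §3.4 / [KO];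
  generic fibre dimension of the proper map `Φ_{|Y}`).
* **Atypicality** (Def. 4.1–4.2, 1.8): `hodgeCodim D Y = dim D_{G_Y} - dim Φ(Y^an)` and
  `IsAtypicalSubvariety D Ssing Y :↔ Y ⊆ Ssing ∨ H-cd(Y) < H-cd(S)`. The first clause of BKU's
  definition ("`Y` is singular for `𝕍`", i.e. `Y ⊆ Φ⁻¹((Φ(S^an))^sing)`, Def. 1.6) refers to the
  singular locus of the analytic variety `Φ(S^an)`, which has no counterpart here: it is the
  explicit PARAMETER `Ssing : Set (ComplexPoints S)` (for honest `D` a strict closed algebraic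
  subvariety, BKU Rmk. 1.7), to be supplied — like `D` itself — by the statement that uses it.
* `IsMaximalAtypicalSpecialSubvariety D Ssing Y` (§2.1, Thm. 2.1/2.6, Conj. 4.11), `hodgeLocusPos`
  (`HL(S, 𝕍^⊗)_pos`, Def. 1.2), and, for the "special subvarieties of vector type" of
  Cattani–Deligne–Kaplan, `hodgeLocusOfVector D s p u` (where the flat transport of `u ∈ V_ℤ,s`
  stays Hodge of level `p`) and `IsHodgeLocusComponentThrough`.

## Not here
* The LEVEL of `𝕍` (BKU Def. 3.12–3.13: minimum over the `ℚ`-simple factors of `𝔤^ad` of their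
  Hodge levels) — it needs the decomposition of the derived Mumford–Tate Lie algebra into
  `ℚ`-simple ideals; "factorwise positive period dimension" (Def. 1.2) and `HL(S, 𝕍^⊗)_fpos`
  (they coincide with the plain notions when `G^ad` is simple); weakly special subvarieties and
  algebraic monodromy (§3.4, Def. 4.3); optimality (Def. 4.5); the BKU theorems themselves (to be
  vendored as named facts over this vocabulary).
* Mathlib has none of: Hodge structures, Mumford–Tate groups/domains, period maps, local systems,
  a Zariski topology on `L`-points, Zilber–Pink notions (searched `MumfordTate`, `periodMap`,
  `HodgeLocus`, `atypical`, `specialSubvariet`); the tree's `Literature.NumberTheory.Transcendental.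
  IsSpecialSubvariety` / `IsAtypicalComponent` are the torus (`𝔾ₘⁿ`) notions, unrelated types.

## Design notes
* Instance hypotheses follow `Motives/HodgeTensor`: `[HodgeTensorFacts.{0,0}]` and
  finite-dimensionality of the rational fibres `[∀ s, Module.Finite ℚ (D.V.fiber s)]` (true for
  honest `D`, `V_s = V_ℤ,s ⊗ ℚ` with `V_ℤ,s` finitely generated) on exactly the declarations that
  use Mumford–Tate groups; the period-map notions need neither.
* `ℕ`-valued dimensions with documented junk values (`0` for empty / infinite-dimensional sets,
  suprema in `ℕ`), as `Motives.schemeDim`; the two subtractions (`periodDim`, `hodgeCodim`) are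
  genuine for honest `D`.
* Paths are taken in `S(ℂ)` with its analytic topology (`AlgPoints.instTopologicalSpace`); the
  Zariski topology lives on the synonym `ZariskiPoints`, never as a second instance on `AlgPoints`.

## References
* [BaldiKlinglerUllmo2024] G. Baldi, B. Klingler, E. Ullmo, Invent. Math. 235 (2024) 441–487
  (arXiv:2107.08838): Def. 1.2, 1.6, 1.8, Lemma 3.6, §3.1–3.4, Def. 4.1–4.2, Conj. 4.11, Thm. 2.1,
  2.3, 2.6, Cor. 2.7.
* [KlinglerOtwinowskaUrbanik2023] B. Klingler, A. Otwinowska, D. Urbanik, Ann. Sci. ÉNS (2023), §1.1,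
  Prop. 2.1.
* [CattaniDeligneKaplan1995JAMS] E. Cattani, P. Deligne, A. Kaplan, JAMS 8 (1995), Thm. 1.1, Cor. 1.2.
* [Deligne1982HodgeCycles] P. Deligne, Hodge cycles on abelian varieties, LNM 900, I §3.
-/

open scoped TensorProduct PiTensorProduct
open CategoryTheory AlgebraicGeometry

noncomputable section

namespace Literature.AlgebraicGeometry.Motives

universe u

/-! ### The derivation action of `𝔤𝔩(V)` on tensor spaces and the Mumford–Tate Lie algebra -/

section LieAlgebra

variable {V : Type u} [AddCommGroup V] [Module ℚ V]

variable (V) in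
/-- The **derivation (Leibniz) action** of an endomorphism `X ∈ 𝔤𝔩(V)` on the tensor power
`V^{⊗r}`: `X · (v₁ ⊗ ⋯ ⊗ v_r) = Σᵢ v₁ ⊗ ⋯ ⊗ X vᵢ ⊗ ⋯ ⊗ v_r`, i.e. the differential at `1` of
`g ↦ g^{⊗r}`; as a `ℚ`-linear map in `X` (sum over `i` of Mathlib's
`PiTensorProduct.mapMultilinear` with all other slots frozen at `id`). [folklore] -/
def tensorPowerDeriv (r : ℕ) : Module.End ℚ V →ₗ[ℚ] Module.End ℚ (⨂[ℚ]^r V) :=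
  ∑ i : Fin r, (PiTensorProduct.mapMultilinear ℚ (fun _ : Fin r => V) (fun _ : Fin r => V)).toLinearMap
    (fun _ => LinearMap.id) i

/-- The derivation action on pure tensors: `X · (⊗ᵢ vᵢ) = Σᵢ ⊗ⱼ (update v i (X vᵢ))ⱼ`. [folklore] -/
theorem tensorPowerDeriv_tprod (r : ℕ) (X : Module.End ℚ V) (v : Fin r → V) :
    tensorPowerDeriv V r X (PiTensorProduct.tprod ℚ v) =
      ∑ i, PiTensorProduct.tprod ℚ (Function.update v i (X (v i))) := by
  simp only [tensorPowerDeriv, LinearMap.sum_apply, MultilinearMap.toLinearMap_apply,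
    PiTensorProduct.mapMultilinear_apply, PiTensorProduct.map_tprod]
  refine Finset.sum_congr rfl fun i _ => ?_
  congr 1
  funext j
  exact Function.apply_update (fun k (F : Module.End ℚ V) => F (v k)) (fun _ => LinearMap.id) i X j

variable (V) in
/-- The **derivation action** of `X ∈ 𝔤𝔩(V)` on the tensor space `T^{a,b} V = V^{⊗a} ⊗ (V^∨)^{⊗b}`:
`X` acts by the Leibniz rule on `V^{⊗a}` and by the Leibniz rule for the contragredient `-Xᵀ` on
`(V^∨)^{⊗b}` — the differential at `1` of the action `tensorSpaceAct` of `GL(V)`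
(Deligne, LNM 900, I §3.1). Linear in `X`. [folklore] -/
def tensorSpaceDeriv (a b : ℕ) : Module.End ℚ V →ₗ[ℚ] Module.End ℚ (hodgeTensorSpace V a b) :=
  (LinearMap.rTensorHom (⨂[ℚ]^b (Module.Dual ℚ V))).comp (tensorPowerDeriv V a) +
    (LinearMap.lTensorHom (⨂[ℚ]^a V)).comp
      ((tensorPowerDeriv (Module.Dual ℚ V) b).comp (-(Module.Dual.transpose (R := ℚ))))

/-- The derivation action on a tensor `x ⊗ ξ ∈ V^{⊗a} ⊗ (V^∨)^{⊗b}`: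
`X · (x ⊗ ξ) = (X · x) ⊗ ξ - x ⊗ (Xᵀ · ξ)`. [folklore] -/
theorem tensorSpaceDeriv_tmul (a b : ℕ) (X : Module.End ℚ V) (x : ⨂[ℚ]^a V)
    (ξ : ⨂[ℚ]^b (Module.Dual ℚ V)) :
    tensorSpaceDeriv V a b X (x ⊗ₜ[ℚ] ξ) =
      tensorPowerDeriv V a X x ⊗ₜ[ℚ] ξ -
        x ⊗ₜ[ℚ] tensorPowerDeriv (Module.Dual ℚ V) b X.dualMap ξ := by
  simp only [tensorSpaceDeriv, LinearMap.add_apply, LinearMap.comp_apply, LinearMap.neg_apply,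
    LinearMap.coe_rTensorHom, LinearMap.coe_lTensorHom, LinearMap.rTensor_tmul,
    LinearMap.lTensor_tmul, map_neg, ← LinearMap.dualMap_def, sub_eq_add_neg]

/-- The generator `id` of the homotheties acts on `V^{⊗r}` by `r`. [folklore] -/
theorem tensorPowerDeriv_id (r : ℕ) :
    tensorPowerDeriv V r LinearMap.id = (r : ℚ) • (LinearMap.id : Module.End ℚ (⨂[ℚ]^r V)) := by
  ext v
  simp [tensorPowerDeriv_tprod, Finset.sum_const, Nat.cast_smul_eq_nsmul]

/-- The generator `id` of the homotheties acts on `T^{a,b} V` by the scalar `a - b` (the weight of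
the action of `𝔾ₘ ⊆ GL(V)`). [folklore] -/
theorem tensorSpaceDeriv_id (a b : ℕ) :
    tensorSpaceDeriv V a b LinearMap.id =
      ((a : ℚ) - b) • (LinearMap.id : Module.End ℚ (hodgeTensorSpace V a b)) := by
  have hs : ((a : ℚ) - b) • (LinearMap.id : Module.End ℚ (hodgeTensorSpace V a b)) =
      (a : ℚ) • LinearMap.id - (b : ℚ) • LinearMap.id :=
    sub_smul (a : ℚ) (b : ℚ) (LinearMap.id : Module.End ℚ (hodgeTensorSpace V a b))
  rw [hs]
  simp [tensorSpaceDeriv, ← LinearMap.dualMap_def, LinearMap.dualMap_id, tensorPowerDeriv_id,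
    LinearMap.rTensor_id, LinearMap.lTensor_id]
  abel

namespace HodgeStructure

variable [HodgeTensorFacts.{u, u}] [Module.Finite ℚ V] {n : ℤ}

/-- The **Mumford–Tate Lie algebra** `𝔪𝔱(H) = Lie MT(H) ⊆ 𝔤𝔩(V)` of a Hodge structure `H` on a
finite-dimensional `V`: the endomorphisms `X` annihilating (under the derivation action
`tensorSpaceDeriv`) every rational tensor `t ∈ T^{a,b} V` of weight `0` and type `(0,0)` — the
tensors whose common stabiliser in `GL(V)` is `MT(H)` (`HodgeStructure.mumfordTateGroup`; Deligne,
LNM 900, I Prop. 3.4; Baldi–Klingler–Ullmo §3.1: "`MT(V)` … is also the fixator in `GL(V)` of the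
Hodge tensors"; this holds for polarizable `H`, in general the stabiliser contains `MT(H)`).
Since a stabiliser subgroup scheme in characteristic `0` is smooth, its Lie algebra is this
annihilator; it is recorded as a `ℚ`-submodule of `End V` (closure under the bracket, which holds,
is not needed here). [cite: Deligne1982HodgeCycles, I Prop. 3.4] -/
def mumfordTateLieAlgebra (H : HodgeStructure V n) : Submodule ℚ (Module.End ℚ V) where
  carrier := {X | ∀ a b : ℕ, ((a : ℤ) - b) * n = 0 →
    ∀ t ∈ (H.tensorSpace a b).hodgeClasses 0, tensorSpaceDeriv V a b X t = 0}
  zero_mem' a b _ t _ := by simp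
  add_mem' {X Y} hX hY a b hab t ht := by simp [map_add, hX a b hab t ht, hY a b hab t ht]
  smul_mem' c X hX a b hab t ht := by simp [map_smul, hX a b hab t ht]

/-- Membership in the Mumford–Tate Lie algebra, unfolded. [folklore] -/
theorem mem_mumfordTateLieAlgebra_iff (H : HodgeStructure V n) (X : Module.End ℚ V) :
    X ∈ H.mumfordTateLieAlgebra ↔ ∀ a b : ℕ, ((a : ℤ) - b) * n = 0 →
      ∀ t ∈ (H.tensorSpace a b).hodgeClasses 0, tensorSpaceDeriv V a b X t = 0 :=
  Iff.rfl

/-- In nonzero weight the homotheties lie in the Mumford–Tate group: `id ∈ 𝔪𝔱(H)` for `n ≠ 0`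
(Deligne, LNM 900, I 3.4: `MT(H) ⊇ w(𝔾ₘ)`; the weight-`0` tensor spaces are the `T^{a,a}`, on
which `id` acts by `a - a = 0`). The Lie-algebra form of the named fact
`HodgeStructure.homothety_mem_mumfordTateGroup`, proved. [cite: Deligne1982HodgeCycles, I 3.4] -/
theorem id_mem_mumfordTateLieAlgebra (H : HodgeStructure V n) (hn : n ≠ 0) :
    LinearMap.id ∈ H.mumfordTateLieAlgebra := by
  intro a b hab t _
  have h : (a : ℚ) - b = 0 := by
    have : (a : ℤ) - b = 0 := (mul_eq_zero.mp hab).resolve_right hn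
    exact_mod_cast this
  simp [tensorSpaceDeriv_id, h]

/-- The **dimension of the Mumford–Tate group** `dim MT(H) = dim_ℚ 𝔪𝔱(H)` (Baldi–Klingler–Ullmo
§3.2: Hodge-generic points are those where `MT(𝕍_s)` "has maximal dimension"). [cite: BaldiKlinglerUllmo2024, §3.2] -/
def mtRank (H : HodgeStructure V n) : ℕ :=
  Module.finrank ℚ H.mumfordTateLieAlgebra

/-- In nonzero weight (and `V ≠ 0`) the Mumford–Tate group has positive dimension: it contains
the homotheties (`id_mem_mumfordTateLieAlgebra`). [folklore] -/
theorem mtRank_pos [Nontrivial V] (H : HodgeStructure V n) (hn : n ≠ 0) : 0 < H.mtRank := by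
  rw [mtRank, Module.finrank_pos_iff_exists_ne_zero]
  refine ⟨⟨LinearMap.id, H.id_mem_mumfordTateLieAlgebra hn⟩, fun h => ?_⟩
  have h' : (LinearMap.id : Module.End ℚ V) = 0 := congrArg Subtype.val h
  exact one_ne_zero h'

/-- The **dimension of the Mumford–Tate domain** `D_{MT(H)} = MT(H)(ℝ)⁺ · h` through `H`:
`dim_ℂ D = dim_ℂ 𝔪𝔱_ℂ / F⁰ 𝔪𝔱_ℂ`, where `F⁰` is induced by the weight-`0` Hodge structure
`End(V) = V ⊗ V^∨` (`HodgeStructure.hom H H`): the holomorphic tangent space of a Mumford–Tate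
domain at `x` is `𝔤_ℂ / F⁰_x 𝔤_ℂ` (Baldi–Klingler–Ullmo §3.3 and §4.3, "`T_x D^∨ = 𝔤_ℂ / F⁰_x 𝔤_ℂ`").
Written as a difference of `finrank`s (a genuine one: `F⁰ 𝔪𝔱_ℂ ⊆ 𝔪𝔱_ℂ`). [cite: BaldiKlinglerUllmo2024, §4.3] -/
def mtDomainDim (H : HodgeStructure V n) : ℕ :=
  Module.finrank ℂ ↥(H.mumfordTateLieAlgebra.baseChange ℂ) -
    Module.finrank ℂ ↥(H.mumfordTateLieAlgebra.baseChange ℂ ⊓ (H.hom H).F 0)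

end HodgeStructure

end LieAlgebra

/-! ### `L`-points with the Zariski topology; irreducible algebraic subvarieties on points -/

section Zariski

variable {k : Type u} [Field k]

/-- `T(L)` equipped with the **Zariski topology**: the topology induced from the scheme `T` along
`P ↦ P.pt` (so its closed sets are exactly the sets `Z(L)`, `Z ⊆ T` closed:
`isZariskiClosedOnPoints_iff_isClosed`). A type synonym of `AlgPoints T L`, which itself carries
the strong (analytic) topology `AlgPoints.instTopologicalSpace`. [folklore] -/
def ZariskiPoints (T : SchemeOver k) (L : Type u) [Field L] [Algebra k L] : Type u := AlgPoints T L

variable {T : SchemeOver k} {L : Type u} [Field L] [Algebra k L]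

/-- The identity `T(L)_{Zar} → T(L)`. [folklore] -/
def ZariskiPoints.val (P : ZariskiPoints T L) : AlgPoints T L := P

/-- The Zariski topology on `T(L)`: induced from the underlying space of the scheme `T` along
`P ↦ P.pt` (Mumford, *Red Book*, I.10 / II.4: closed points of `T` versus `L`-points). [folklore] -/
instance ZariskiPoints.instTopologicalSpace : TopologicalSpace (ZariskiPoints T L) :=
  TopologicalSpace.induced (fun P : ZariskiPoints T L => P.val.pt) inferInstance

variable (T) in
/-- View a set of `L`-points in `T(L)` with the Zariski topology. [folklore] -/
def zariskiSet (A : Set (AlgPoints T L)) : Set (ZariskiPoints T L) := ZariskiPoints.val ⁻¹' A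

/-- Membership in `zariskiSet` is membership. [folklore] -/
@[simp] theorem mem_zariskiSet_iff (A : Set (AlgPoints T L)) (P : ZariskiPoints T L) :
    P ∈ zariskiSet T A ↔ P.val ∈ A := Iff.rfl

/-- `IsZariskiClosedOnPoints T A` (`A = Z(L)` for a closed `Z ⊆ T`, `Motives/FamiliesVHS`) says
exactly that `A` is closed in the Zariski topology on `T(L)`. [folklore] -/
theorem isZariskiClosedOnPoints_iff_isClosed (A : Set (AlgPoints T L)) :
    IsZariskiClosedOnPoints T A ↔ IsClosed (zariskiSet T A) := by
  rw [isClosed_induced_iff]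
  constructor
  · rintro ⟨Z, hZ, rfl⟩
    exact ⟨Z, hZ, rfl⟩
  · rintro ⟨Z, hZ, hZA⟩
    exact ⟨Z, hZ, hZA.symm⟩

variable (T) in
/-- `A ⊆ T(L)` **is (the set of `L`-points of) an irreducible closed algebraic subvariety**: `A` is
closed and irreducible for the Zariski topology on `T(L)` (for `T` of finite type over `k = L`
algebraically closed: `A = Y(L)` for a unique irreducible closed `Y ⊆ T`, the closure of `A`).
BKU §3.1: "by a subvariety `Y ⊂ S` we always mean a closed algebraic subvariety". [folklore] -/
def IsIrreducibleZariskiClosedOnPoints (A : Set (AlgPoints T L)) : Prop :=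
  IsClosed (zariskiSet T A) ∧ IsIrreducible (zariskiSet T A)

variable (T) in
/-- The **dimension** of a set of `L`-points `A ⊆ T(L)`: the Krull dimension of `A` with the
(subspace of the) Zariski topology (Mathlib `topologicalKrullDim`), as a natural number with junk
value `0` for `A = ∅` or infinite-dimensional `A` (as `Motives.schemeDim`). For `A = Y(ℂ)`, `Y` a
closed subvariety of `T` of finite type over `ℂ`, this is `dim Y` (closed points are dense in
every closed subset). [folklore] -/
def zariskiDimOnPoints (A : Set (AlgPoints T L)) : ℕ :=
  ((topologicalKrullDim (zariskiSet T A)).unbotD 0).toNat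

variable (T) in
/-- `Y` is an **irreducible component** of `A ⊆ T(L)`: an irreducible Zariski-closed set of points
contained in `A` and maximal among such. [folklore] -/
def IsIrredComponentOnPoints (A Y : Set (AlgPoints T L)) : Prop :=
  IsIrreducibleZariskiClosedOnPoints T Y ∧ Y ⊆ A ∧
    ∀ Y' : Set (AlgPoints T L), IsIrreducibleZariskiClosedOnPoints T Y' → Y ⊆ Y' → Y' ⊆ A → Y' = Y

/-- An irreducible component of `A` is contained in `A`. [folklore] -/
theorem IsIrredComponentOnPoints.subset {A Y : Set (AlgPoints T L)}
    (h : IsIrredComponentOnPoints T A Y) : Y ⊆ A := h.2.1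

end Zariski

/-! ### Pointwise Mumford–Tate invariants, Hodge-generic points, period equivalence -/

namespace VHSData

section Topological

variable {S : Type} [TopologicalSpace S] {n : ℤ} (D : VHSData S n)

/-- Complexified parallel transport `(γ_*)_ℂ : V_{s,ℂ} → V_{t,ℂ}` of the rational local system
along a homotopy class of paths. [folklore] -/
def transportℂ {s t : S} (γ : Path.Homotopic.Quotient s t) :
    ℂ ⊗[ℚ] D.V.fiber s →ₗ[ℂ] ℂ ⊗[ℚ] D.V.fiber t :=
  (D.V.transport γ).baseChange ℂ

/-- Complexified transport along the constant path is the identity. [folklore] -/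
@[simp]
theorem transportℂ_refl (s : S) : D.transportℂ (Path.Homotopic.Quotient.refl s) = LinearMap.id := by
  simp [transportℂ]

/-- **Period equivalence** of two points `s, t ∈ S`: parallel transport along *some* path from
`s` to `t` carries the Hodge filtration `F^• V_s` onto `F^• V_t`. In terms of the period map
`Φ : S^an → Γ \ D` of `D` (BKU §3.3: `Φ(s)` is the class of `h_s`, the lift `Φ̃` to universal
covers being transport of the Hodge filtration to a base point), `PeriodEquiv s t` says that the
lifts of `s` and `t` along that path have the same image under `Φ̃`; in particular `Φ(s) = Φ(t)`,
and conversely the points of the connected component through `s` of the fibre `Φ⁻¹(Φ(s))` are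
period-equivalent to `s` (on a connected set where `Φ` is constant, `Φ̃` is constant along paths,
`Γ` acting properly discontinuously on `D`). Uses only `(V, F^•)`. [cite: BaldiKlinglerUllmo2024, §3.3] -/
def PeriodEquiv (s t : S) : Prop :=
  ∃ γ : Path.Homotopic.Quotient s t, ∀ p : ℤ, ((D.hodge s).F p).map (D.transportℂ γ) = (D.hodge t).F p

/-- Every point is period-equivalent to itself (constant path). [folklore] -/
theorem periodEquiv_refl (s : S) : D.PeriodEquiv s s :=
  ⟨Path.Homotopic.Quotient.refl s, fun p => by simp⟩

/-- `Y ⊆ S` **has positive period dimension** for `D` (BKU Def. 1.2: "`Φ(Y^an)` has positive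
dimension", i.e. — `Y^an` being connected for `Y` irreducible — the period map is not constant on
`Y`): two points of `Y` are not period-equivalent. For `Y^an` connected, `Φ` is constant on `Y` iff
all pairs of points of `Y` are period-equivalent (see `PeriodEquiv`), so this is the printed notion
for `D` underlying an honest polarized `ℤ`VHS. [cite: BaldiKlinglerUllmo2024, Def. 1.2] -/
def HasPositivePeriodDimension (Y : Set S) : Prop :=
  ∃ y ∈ Y, ∃ y' ∈ Y, ¬D.PeriodEquiv y y'

/-- Points have period dimension zero. [folklore] -/
theorem not_hasPositivePeriodDimension_singleton (s : S) : ¬D.HasPositivePeriodDimension {s} := by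
  rintro ⟨y, hy, y', hy', h⟩
  rw [Set.mem_singleton_iff] at hy hy'
  subst hy hy'
  exact h (D.periodEquiv_refl _)

/-- The **Hodge locus of the integral vector `u ∈ V_ℤ,s` in level `p`** ("vector type", as opposed
to tensors): the points `t ∈ S` such that the flat transport of `u` along some path from `s` to `t`
is a Hodge class of level `p` at `t` — the projection to `S` of the leaf through `u` of the locus of
Hodge classes in the étalé space of `V_ℤ` (Cattani–Deligne–Kaplan 1995, §1: "the locus where `u`
remains of type `(p,p)`"; KOU 2023 §1.1.1, `HL(S, 𝕍)` versus the tensorial `HL(S, 𝕍^⊗)`). By CDK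
Thm. 1.1 it is a finite union of closed algebraic subvarieties when `D` underlies a polarized `ℤ`VHS
over a quasi-projective `S`. [cite: CattaniDeligneKaplan1995JAMS, §1, Thm. 1.1 and Cor. 1.2] -/
def hodgeLocusOfVector (s : S) (p : ℤ) (u : D.VZ.fiber s) : Set S :=
  {t | ∃ γ : Path.Homotopic.Quotient s t, D.IsHodgeAt t p (D.VZ.transport γ u)}

/-- If `u` is Hodge at `s` then `s` lies on the Hodge locus of `u` (constant path). [folklore] -/
theorem mem_hodgeLocusOfVector_self {s : S} {p : ℤ} {u : D.VZ.fiber s} (h : D.IsHodgeAt s p u) :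
    s ∈ D.hodgeLocusOfVector s p u :=
  ⟨Path.Homotopic.Quotient.refl s, by simpa using h⟩

variable [HodgeTensorFacts.{0, 0}] [∀ s : S, Module.Finite ℚ (D.V.fiber s)]

/-- `dim MT(V_s)`, the dimension of the Mumford–Tate group of the Hodge structure on the fibre at
`s` (`HodgeStructure.mtRank`). [cite: BaldiKlinglerUllmo2024, §3.2] -/
def mtRankAt (s : S) : ℕ := (D.hodge s).mtRank

/-- `dim_ℂ D_{MT(V_s)}`, the dimension of the Mumford–Tate domain of the Hodge structure on the
fibre at `s` (`HodgeStructure.mtDomainDim`). [cite: BaldiKlinglerUllmo2024, §3.3] -/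
def mtDomainDimAt (s : S) : ℕ := (D.hodge s).mtDomainDim

/-- `s` is **Hodge-generic in `Y`** for `D`: `s ∈ Y` and `MT(V_s)` has maximal dimension as `s`
ranges through `Y` (BKU §3.2, verbatim). The Mumford–Tate group at a Hodge-generic point is the
*generic Mumford–Tate group* `G_Y` of `Y`. [cite: BaldiKlinglerUllmo2024, §3.2] -/
def IsHodgeGenericIn (Y : Set S) (s : S) : Prop :=
  s ∈ Y ∧ ∀ y ∈ Y, D.mtRankAt y ≤ D.mtRankAt s

/-- The (tensorial) **Hodge locus** `HL(S, 𝕍^⊗)`: the points of `S` which are not Hodge-generic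
in `S` (BKU §3.2: "The Hodge locus `HL(S, 𝕍^⊗)` is also the subset of points of `S` which are not
Hodge-generic in `S` for `𝕍`"; for `S` irreducible). [cite: BaldiKlinglerUllmo2024, §3.2] -/
def hodgeLocus : Set S := {s | ¬D.IsHodgeGenericIn Set.univ s}

/-- Membership in the Hodge locus: some point of `S` has a Mumford–Tate group of larger
dimension. [folklore] -/
theorem mem_hodgeLocus_iff (s : S) : s ∈ D.hodgeLocus ↔ ∃ t : S, D.mtRankAt s < D.mtRankAt t := by
  simp [hodgeLocus, IsHodgeGenericIn]

/-- `dim G_Y`, the dimension of the **generic Mumford–Tate group** of `Y ⊆ S`: the maximum of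
`dim MT(V_y)` over `y ∈ Y` (BKU §3.2). A supremum in `ℕ` (junk value `0` if unbounded; for `D`
on a connected base the ranks are bounded by `(rk V)²`). [cite: BaldiKlinglerUllmo2024, §3.2] -/
def genericMTRank (Y : Set S) : ℕ := ⨆ y : Y, D.mtRankAt y

/-- `dim_ℂ D_{G_Y}`, the dimension of the **Mumford–Tate domain of the generic Hodge datum**
`(G_Y, D_{G_Y})` of `Y` (BKU §3.3–3.4): the maximum over `y ∈ Y` of `dim_ℂ D_{MT(V_y)}` — for every
`y ∈ Y`, `D_{MT(V_y)} = MT(V_y)(ℝ)⁺ · h_y` is a Mumford–Tate subdomain of `D_{G_Y} = G_Y(ℝ)⁺ · h_y`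
(`MT(V_y) ⊆ G_Y`), equal to it at Hodge-generic points, so the maximum is `dim D_{G_Y}`. Supremum
in `ℕ` as in `genericMTRank`. [cite: BaldiKlinglerUllmo2024, §3.3–3.4] -/
def genericPeriodDomainDim (Y : Set S) : ℕ := ⨆ y : Y, D.mtDomainDimAt y

/-- A Hodge-generic point of `Y` lies in `Y`. [folklore] -/
theorem IsHodgeGenericIn.mem {Y : Set S} {s : S} (h : D.IsHodgeGenericIn Y s) : s ∈ Y := h.1

/-- The Mumford–Tate rank at a point of `Y` is at most the generic Mumford–Tate rank of `Y`
(when the ranks on `Y` are bounded). [folklore] -/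
theorem mtRankAt_le_genericMTRank {Y : Set S} (hY : BddAbove (Set.range fun y : Y => D.mtRankAt y))
    {y : S} (hy : y ∈ Y) : D.mtRankAt y ≤ D.genericMTRank Y :=
  le_ciSup hY ⟨y, hy⟩

end Topological

/-! ### Special, atypical and maximal atypical special subvarieties (complex points of a `ℂ`-scheme) -/

section Complex

variable {S : SchemeOver ℂ} {n : ℤ} (D : VHSData (ComplexPoints S) n)

/-- The **period fibre of `Y` through `y`**: the points of `Y` period-equivalent to `y`. For `D`
underlying a polarized `ℤ`VHS with (proper) period map `Φ` and `Y` closed algebraic, this is the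
trace on `Y` of a union of connected components of the fibre `Φ⁻¹(Φ(y))`, hence Zariski closed:
fibres of period maps are algebraic (BKU §3.4: "the preimage under `Φ` of any weakly special
subvariety of `Γ \ D` is an algebraic subvariety of `S`", every point being weakly special).
[cite: BaldiKlinglerUllmo2024, §3.4] -/
def periodFibre (Y : Set (ComplexPoints S)) (y : ComplexPoints S) : Set (ComplexPoints S) :=
  {y' | y' ∈ Y ∧ D.PeriodEquiv y y'}

/-- The period fibre through `y` is contained in `Y`. [folklore] -/
theorem periodFibre_subset (Y : Set (ComplexPoints S)) (y : ComplexPoints S) :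
    D.periodFibre Y y ⊆ Y := fun _ h => h.1

/-- A point of `Y` lies on its own period fibre. [folklore] -/
theorem mem_periodFibre_self {Y : Set (ComplexPoints S)} {y : ComplexPoints S} (hy : y ∈ Y) :
    y ∈ D.periodFibre Y y := ⟨hy, D.periodEquiv_refl y⟩

/-- The **period dimension** `dim_ℂ Φ(Y^an)` of `Y ⊆ S(ℂ)` (BKU Def. 1.2, §3.3), rendered without
the period map as `dim Y - min_{y ∈ Y} dim (period fibre of Y through y)`: for `Φ_{|Y}` a proper
holomorphic map of the irreducible `Y^an` onto the analytic variety `Φ(Y^an)` (BKU §3.3 arrange `Φ`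
proper), `dim Φ(Y^an) = dim Y -` (generic fibre dimension), the fibre dimension is upper
semicontinuous with generic value its minimum, and the period fibres are algebraic
(`periodFibre`) so that their dimension is the Zariski one. Natural-number subtraction, a genuine
one (fibres are subsets of `Y`). Junk (like `zariskiDimOnPoints`) when `Y` is empty or not
algebraic. [cite: BaldiKlinglerUllmo2024, Def. 1.2 and §3.3–3.4] -/
def periodDim (Y : Set (ComplexPoints S)) : ℕ :=
  zariskiDimOnPoints S Y - ⨅ y : Y, zariskiDimOnPoints S (D.periodFibre Y y)

/-- `Y` is **an irreducible component through `s` of the Hodge locus of the vector `u ∈ V_ℤ,s`**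
(level `p`): the "special subvarieties of vector type" through `s` (Cattani–Deligne–Kaplan 1995,
Cor. 1.2: the germ at `s` of the locus where `u` remains of type `(p,p)` is algebraic; KOU 2023,
§1.1.1). [cite: CattaniDeligneKaplan1995JAMS, Cor. 1.2] -/
def IsHodgeLocusComponentThrough (s : ComplexPoints S) (p : ℤ) (u : D.VZ.fiber s)
    (Y : Set (ComplexPoints S)) : Prop :=
  s ∈ Y ∧ IsIrredComponentOnPoints S (D.hodgeLocusOfVector s p u) Y

variable [HodgeTensorFacts.{0, 0}] [∀ s : ComplexPoints S, Module.Finite ℚ (D.V.fiber s)]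

/-- `Y ⊆ S(ℂ)` is a **special subvariety** of `S` for `D` (BKU Def. 3.3, in the intrinsic form of
BKU Lemma 3.6 = KOU Prop. 2.1: "the closed irreducible algebraic subvarieties `Y ⊂ S` maximal among
the closed irreducible algebraic subvarieties `Z` of `S` such that `G_Z = G_Y`"): `Y` is (the set of
complex points of) an irreducible closed subvariety, and every strictly larger irreducible closed
`Z ⊋ Y` has a generic Mumford–Tate group of strictly larger dimension. (For `Y ⊆ Z` one has
`G_Y ⊆ G_Z` up to conjugation by transport, both connected, so `G_Z = G_Y` iff
`dim G_Z = dim G_Y`; `genericMTRank` is monotone.) `S` itself (if irreducible) is special; by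
Cattani–Deligne–Kaplan the Hodge locus is the countable union of the strict special subvarieties.
[cite: BaldiKlinglerUllmo2024, Def. 3.3 and Lemma 3.6] -/
def IsSpecialSubvariety (Y : Set (ComplexPoints S)) : Prop :=
  IsIrreducibleZariskiClosedOnPoints S Y ∧
    ∀ Z : Set (ComplexPoints S), IsIrreducibleZariskiClosedOnPoints S Z → Y ⊂ Z →
      D.genericMTRank Y < D.genericMTRank Z

/-- A **strict** special subvariety: a special subvariety other than `S` (BKU §1.1, §3.4: the
Hodge locus `HL(S, 𝕍^⊗)` is the countable union of the strict special subvarieties). [cite: BaldiKlinglerUllmo2024, §3.4] -/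
def IsStrictSpecialSubvariety (Y : Set (ComplexPoints S)) : Prop :=
  D.IsSpecialSubvariety Y ∧ Y ≠ Set.univ

/-- A special subvariety is an irreducible closed subvariety (on complex points). [folklore] -/
theorem IsSpecialSubvariety.isIrreducibleZariskiClosedOnPoints {Y : Set (ComplexPoints S)}
    (h : D.IsSpecialSubvariety Y) : IsIrreducibleZariskiClosedOnPoints S Y := h.1

/-- The **Hodge locus of positive period dimension** `HL(S, 𝕍^⊗)_pos`: the union of the strict
special subvarieties of `S` for `D` of positive period dimension (BKU Def. 1.2). (BKU write
"special"; the inclusion `HL(S, 𝕍^⊗)_pos ⊆ HL(S, 𝕍^⊗)` printed right after shows strict ones are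
meant.) [cite: BaldiKlinglerUllmo2024, Def. 1.2] -/
def hodgeLocusPos : Set (ComplexPoints S) :=
  ⋃₀ {Y | D.IsStrictSpecialSubvariety Y ∧ D.HasPositivePeriodDimension Y}

/-- The **Hodge codimension** `H-cd(Y, 𝕍) = dim D_{G_Y} - dim Φ(Y^an)` of `Y ⊆ S(ℂ)` (BKU Def. 4.1),
with `genericPeriodDomainDim` for `dim D_{G_Y}` and `periodDim` for `dim Φ(Y^an)`. Natural-number
subtraction; a genuine one for honest `D` since `Φ(Y^an) ⊆ Γ_{G_Y} \ D_{G_Y}`. [cite: BaldiKlinglerUllmo2024, Def. 4.1] -/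
def hodgeCodim (Y : Set (ComplexPoints S)) : ℕ :=
  D.genericPeriodDomainDim Y - D.periodDim Y

/-- `Y ⊆ S(ℂ)` is **atypical** for `D` (BKU Def. 4.2, and Def. 1.8 for special `Y`): either `Y` is
*singular for `𝕍`*, i.e. contained in the singular locus `S^sing_𝕍 = Φ⁻¹((Φ(S^an))^sing)`
(BKU Def. 1.6), or `Φ(S^an)` and `Γ_{G_Y} \ D_{G_Y}` meet with excess dimension along `Φ(Y^an)`:
`H-cd(Y, 𝕍) < H-cd(S, 𝕍)`, i.e.
`codim Φ(Y^an) < codim Φ(S^an) + codim Γ_{G_Y} \ D_{G_Y}` in `Γ \ D`. Otherwise `Y` is *typical*.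
The singular locus of the analytic variety `Φ(S^an)` is not constructible from `D` in this tree:
it enters as the PARAMETER `Ssing` (for honest `D` a strict closed algebraic subvariety of `S`,
BKU Rmk. 1.7); `H-cd(S, 𝕍)` is `hodgeCodim` of `S(ℂ) = Set.univ` (`S` irreducible). [cite: BaldiKlinglerUllmo2024, Def. 4.2, Def. 1.8 and Def. 1.6] -/
def IsAtypicalSubvariety (Ssing Y : Set (ComplexPoints S)) : Prop :=
  Y ⊆ Ssing ∨ D.hodgeCodim Y < D.hodgeCodim Set.univ

/-- Subvarieties singular for `𝕍` are atypical (first clause of BKU Def. 4.2). [folklore] -/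
theorem isAtypicalSubvariety_of_subset {Ssing Y : Set (ComplexPoints S)} (h : Y ⊆ Ssing) :
    D.IsAtypicalSubvariety Ssing Y := Or.inl h

/-- `Y ⊆ S(ℂ)` is a **maximal atypical special subvariety** of `S` for `D` (BKU §2.1, Thm. 2.1,
Thm. 2.6, Conj. 4.11: "maximal elements for the inclusion" among the atypical special
subvarieties): `Y` is special and atypical, and no strictly larger special subvariety is atypical.
`Ssing` is the singular locus of `S` for `𝕍` (see `IsAtypicalSubvariety`). BKU's "maximal atypical
special subvarieties of positive period dimension" are those satisfying moreover
`HasPositivePeriodDimension`; Thm. 2.6: in level `≥ 3`, `HL(S, 𝕍^⊗)_fpos` is a finite union of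
maximal atypical special subvarieties. [cite: BaldiKlinglerUllmo2024, §2.1, Thm. 2.1 and Thm. 2.6] -/
def IsMaximalAtypicalSpecialSubvariety (Ssing Y : Set (ComplexPoints S)) : Prop :=
  D.IsSpecialSubvariety Y ∧ D.IsAtypicalSubvariety Ssing Y ∧
    ∀ Z : Set (ComplexPoints S), D.IsSpecialSubvariety Z → D.IsAtypicalSubvariety Ssing Z →
      Y ⊆ Z → Z = Y

/-- A maximal atypical special subvariety is special. [folklore] -/
theorem IsMaximalAtypicalSpecialSubvariety.isSpecialSubvariety {Ssing Y : Set (ComplexPoints S)}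
    (h : D.IsMaximalAtypicalSpecialSubvariety Ssing Y) : D.IsSpecialSubvariety Y := h.1

/-- A maximal atypical special subvariety is atypical. [folklore] -/
theorem IsMaximalAtypicalSpecialSubvariety.isAtypicalSubvariety {Ssing Y : Set (ComplexPoints S)}
    (h : D.IsMaximalAtypicalSpecialSubvariety Ssing Y) : D.IsAtypicalSubvariety Ssing Y := h.2.1

/-- Maximality: an atypical special subvariety containing a maximal one equals it. [folklore] -/
theorem IsMaximalAtypicalSpecialSubvariety.eq_of_subset {Ssing Y Z : Set (ComplexPoints S)}
    (h : D.IsMaximalAtypicalSpecialSubvariety Ssing Y) (hZ : D.IsSpecialSubvariety Z)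
    (hZa : D.IsAtypicalSubvariety Ssing Z) (hYZ : Y ⊆ Z) : Z = Y :=
  h.2.2 Z hZ hZa hYZ

end Complex

end VHSData

end Literature.AlgebraicGeometry.Motives

end
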